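import Mathlib
import Summits.MatrixMultiplication.MatrixMultiplication.Theses.FidelityWitnesses
import Literature.Computability.AlgebraicComplexity.AsymptoticSpectrum

/-!
# Sketch — crux DiagonalPowerDecay (stmt-MatrixMultiplication-14053), crux-ideate round 1, ideator 3

First lemmas of three idea cards, stated over existing declarations (no proofs; this file only has
to elaborate). Conventions of the tree: `matMulTensor ℂ n n n a b c`, legs `a = (κ,ν)`,
`b = (κ,μ)`, `c = (μ,ν)`; `triad w u v a b c = w a * u b * v c`; the crux pairs `S` with `T`
bilinearly, `⟨S,T⟩ = ∑ S a b c * T a b c = ∑_l tr(u_l v_l w_lᵀ)` for `S = ∑_l w_l ⊗ u_l ⊗ v_l`.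

* Card `twirl-boosting-uniform-gap`: `PauliTwirlProjection`, `TwirlBoosting`,
  `ReciprocalDefectLaw`, `UniformFidelityThesis`, `uft_imp_dpd`, `dpd_imp_uft`.
* Card `robust-spectral-point`: `RobustSuperquadraticFunctional`, `robust_imp_uft`,
  `RobustSpectralGap`, `robustSpectralGap_imp_uft`.
* Card `transversal-cut-factor-rank`: `LowFactorRankBound`, `CutRankBound`,
  `OneLegOrthogonalBound`.
-/

open scoped BigOperators ComplexConjugate
open Literature.Computability.AlgebraicComplexity

namespace Summit.MatrixMultiplication.MatrixMultiplication.Cruxes.DiagonalPowerDecay.Ideator3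

/-- A leg of `⟨n,n,n⟩`: an `n × n` index. -/
abbrev Leg (n : ℕ) := Fin n × Fin n

/-- Tensors of the format of `⟨n,n,n⟩`. -/
abbrev Tens (n : ℕ) := Leg n → Leg n → Leg n → ℂ

/-- `T n = ⟨n,n,n⟩` over `ℂ`. -/
noncomputable def T (n : ℕ) : Tens n := matMulTensor ℂ n n n

/-- The bilinear pairing of the crux, `⟨S,T⟩ = ∑ S a b c * T a b c`. -/
noncomputable def pairT {n : ℕ} (S : Tens n) : ℂ := ∑ a, ∑ b, ∑ c, S a b c * T n a b c

/-- Squared Frobenius norm `‖S‖²`. -/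
noncomputable def sqn {n : ℕ} (S : Tens n) : ℝ := ∑ a, ∑ b, ∑ c, ‖S a b c‖ ^ 2

/-- The value of the crux's ratio at `S`: `|⟨S,T⟩|² / ‖S‖²` (junk `0` at `S = 0`). -/
noncomputable def ratio {n : ℕ} (S : Tens n) : ℝ := ‖pairT S‖ ^ 2 / sqn S

/-! ## Card A — stabiliser twirl, boosting, and the uniform-gap transfer -/

/-- Heisenberg–Weyl (clock–shift) matrix `X^a Z^b`: entry `ζ^{b j}` at `(j + a, j)`, `ζ = e^{2πi/n}`. -/
noncomputable def weyl (n : ℕ) (a b : Fin n) : Matrix (Fin n) (Fin n) ℂ :=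
  fun i j => if i.val = (j.val + a.val) % n
    then Complex.exp (2 * Real.pi * Complex.I * (((b.val * j.val : ℕ) : ℂ) / (n : ℂ))) else 0

/-- The local action of `(A, B, C) ∈ U(n)³` fixing `⟨n,n,n⟩`: `A ⊗ C` on leg `a = (κ,ν)`,
`Ā ⊗ B` on leg `b = (κ,μ)`, `B̄ ⊗ C̄` on leg `c = (μ,ν)` (a local unitary on each leg, so it
preserves tensor rank and the Frobenius norm). -/
noncomputable def actH {n : ℕ} (A B C : Matrix (Fin n) (Fin n) ℂ) (S : Tens n) : Tens n :=
  fun a b c => ∑ a' : Leg n, ∑ b' : Leg n, ∑ c' : Leg n,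
    (A a.1 a'.1 * C a.2 a'.2) * (conj (A b.1 b'.1) * B b.2 b'.2) *
      (conj (B c.1 c'.1) * conj (C c.2 c'.2)) * S a' b' c'

/-- **Pauli-twirl projection identity** (finite 1-design form of "`⟨n,n,n⟩` spans the
`U(n)³`-invariants"): summing the local Heisenberg–Weyl action over all `(n²)³` triples projects
any `S` onto the line `ℂ·T`: `∑_h h·S = n³ ⟨S,T⟩ · T` (average `= (⟨S,T⟩/n³) T`). -/
def PauliTwirlProjection : Prop :=
  ∀ (n : ℕ) (S : Tens n),
    (∑ a₁ : Fin n, ∑ b₁ : Fin n, ∑ a₂ : Fin n, ∑ b₂ : Fin n, ∑ a₃ : Fin n, ∑ b₃ : Fin n,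
      actH (weyl n a₁ b₁) (weyl n a₂ b₂) (weyl n a₃ b₃) S)
      = fun a b c => (n : ℂ) ^ 3 * pairT S * T n a b c

/-- **Twirl boosting**: `m` twirled copies of a rank-`≤ r` tensor give a rank-`≤ m r` tensor with
`m` times the overlap and second moment `m‖S‖² + m(m−1)|⟨S,T⟩|²/n³` (expectation over i.i.d.
Heisenberg–Weyl triples; some choice is at most the mean). -/
def TwirlBoosting : Prop :=
  ∀ (n r m : ℕ), 1 ≤ m → ∀ S : Tens n, tensorRank S ≤ r →
    ∃ S' : Tens n, tensorRank S' ≤ m * r ∧ pairT S' = (m : ℂ) * pairT S ∧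
      sqn S' ≤ (m : ℝ) * sqn S + (m : ℝ) * ((m : ℝ) - 1) * ‖pairT S‖ ^ 2 / (n : ℝ) ^ 3

/-- **Reciprocal-defect law** (corollary of `TwirlBoosting`): with `D(S) := n³‖S‖²/|⟨S,T⟩|² − 1`,
the rank budget and the reciprocal defect trade linearly: some `S'` of rank `≤ m r` has
`D(S') ≤ D(S)/m`. In profile form `D(n, m r) ≤ D(n, r)/m`, i.e. `r ↦ r·(n³/M(n,r) − 1)` is
non-increasing along multiples. -/
def ReciprocalDefectLaw : Prop :=
  ∀ (n r m : ℕ), 1 ≤ m → ∀ S : Tens n, tensorRank S ≤ r → pairT S ≠ 0 →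
    ∃ S' : Tens n, tensorRank S' ≤ m * r ∧ pairT S' ≠ 0 ∧
      (n : ℝ) ^ 3 * sqn S' / ‖pairT S'‖ ^ 2 - 1 ≤ ((n : ℝ) ^ 3 * sqn S / ‖pairT S‖ ^ 2 - 1) / m

/-- **Uniform fidelity thesis (UFT)** — the route's target `FidelityThesis` with the gap `ε`
UNIFORM in `n` (pulled in front of `∀ n`), along a superquadratic rank curve `r ≤ c·n^{2+η}`. -/
def UniformFidelityThesis : Prop :=
  ∃ η : ℝ, 0 < η ∧ ∃ ε : ℝ, 0 < ε ∧ ∃ c : ℝ, 0 < c ∧ ∀ (n : ℕ) (S : Tens n),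
    (tensorRank S : ℝ) ≤ c * (n : ℝ) ^ (2 + η) →
      ‖pairT S‖ ^ 2 ≤ (1 - ε) * (n : ℝ) ^ 3 * sqn S

/-- **Transfer, useful direction**: a uniform constant gap at rank `n^{2+η}` boosts down to power
decay at rank `n²` (`m = ⌊n^η⌋` in `ReciprocalDefectLaw`: `D(n,n²) ≥ m·ε/(1−ε)`), i.e. the crux with
`2δ = η`. -/
def uft_imp_dpd : Prop :=
  UniformFidelityThesis → Theses.FidelityWitnesses.DiagonalPowerDecay

/-- **Transfer, converse**: Kronecker super-multiplicativity `M(nn′, rr′) ≥ M(n,r)·M(n′,r′)`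
(`⟨n,n,n⟩ ⊠ ⟨n′,n′,n′⟩ = ⟨nn′,nn′,nn′⟩`) and zero-padding monotonicity turn one high-fidelity
scheme at rank `c·n^{2+η}` into diagonal schemes at sizes `N ≈ n^{k(1+η/2)}` of captured fraction
`≥ (1−ε)^k·2^{-3} N^{-3η/(2+η)}`, contradicting the crux for `η < δ`. So the crux ⟺ UFT. -/
def dpd_imp_uft : Prop :=
  Theses.FidelityWitnesses.DiagonalPowerDecay → UniformFidelityThesis

/-! ## Card B — fidelity-robust superquadratic functionals (robust spectral points) -/

/-- A **robust superquadratic rank functional on the matrix multiplication formats**: (i) a lower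
bound for tensor rank, (ii) superquadratic on `⟨N,N,N⟩`, (iii) FIDELITY-ROBUST at `⟨N,N,N⟩` with
vanishing exponent: fidelity `≥ 1 − ε` with `⟨N,N,N⟩` costs at most a factor `C_ε N^{λ}`, where
`λ → 0` as `ε → 0`. Entropy-of-marginals functionals (quantum functionals, Vrana's family) satisfy
(i) and (iii) (Fannes–Audenaert), and (ii) is exactly "the functional certifies `ω > 2`". -/
def RobustSuperquadraticFunctional : Prop :=
  ∃ F : (∀ {n : ℕ}, Tens n → ℝ),
    (∀ (n : ℕ) (S : Tens n), F S ≤ tensorRank S) ∧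
    (∃ c₀ : ℝ, 0 < c₀ ∧ ∃ γ : ℝ, 0 < γ ∧ ∀ n : ℕ, 1 ≤ n → c₀ * (n : ℝ) ^ (2 + γ) ≤ F (T n)) ∧
    (∀ lam : ℝ, 0 < lam → ∃ ε : ℝ, 0 < ε ∧ ∃ C : ℝ, 0 < C ∧ ∀ (n : ℕ) (S : Tens n), 1 ≤ n →
      (1 - ε) * (n : ℝ) ^ 3 * sqn S ≤ ‖pairT S‖ ^ 2 → F (T n) ≤ C * (n : ℝ) ^ lam * F S)

/-- **Robust functional ⇒ uniform gap** (pure real analysis: rank `≤ c N^{2+η}` and fidelity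
`≥ 1−ε` give `c N^{2+η} ≥ F(S) ≥ C⁻¹N^{-λ}c₀N^{2+γ}`, impossible for `η + λ < γ` and `N` large;
small `N` are absorbed by shrinking `c`). With `uft_imp_dpd` this closes the robustness gap between
the crux and `ω > 2` for every robust-functional method. -/
def robust_imp_uft : Prop :=
  RobustSuperquadraticFunctional → UniformFidelityThesis

/-- The spectral instance: a universal spectral point of complex 3-tensors (tree:
`IsUniversalSpectralPoint`) exceeding the flattening value `4` on `⟨2,2,2⟩` (i.e. a witness of
`ω > 2` by Strassen duality; the negation of crux rank 2 of route AsymptoticSpectrum) which is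
fidelity-robust on the matrix multiplication formats. -/
def RobustSpectralGap : Prop :=
  ∃ F : SpectralMap ℂ, IsUniversalSpectralPoint ℂ F ∧ 4 < F (matMulTensor ℂ 2 2 2) ∧
    (∀ lam : ℝ, 0 < lam → ∃ ε : ℝ, 0 < ε ∧ ∃ C : ℝ, 0 < C ∧ ∀ (n : ℕ) (S : Tens n), 1 ≤ n →
      (1 - ε) * (n : ℝ) ^ 3 * sqn S ≤ ‖pairT S‖ ^ 2 → F (T n) ≤ C * (n : ℝ) ^ lam * F S)

/-- `RobustSpectralGap → UFT`: multiplicativity + restriction-monotonicity give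
`F(⟨N,N,N⟩) ≥ (N/2)^{log₂ F(⟨2,2,2⟩)} = c₀N^{2+γ}` and `F ≤ R`, so `RobustSuperquadraticFunctional`. -/
def robustSpectralGap_imp_uft : Prop :=
  RobustSpectralGap → UniformFidelityThesis

/-! ## Card C — the transversal (row | column) cut -/

/-- The `n × n` matrix carried by a leg vector. -/
def legMatrix {n : ℕ} (x : Leg n → ℂ) : Matrix (Fin n) (Fin n) ℂ := Matrix.of fun i j => x (i, j)

/-- **Low-factor-rank bound** (transversal cut): under `M_n^{⊗3} ≅ M_{n³}` the tensor `⟨n,n,n⟩`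
is a permutation (unitary) matrix, a triad `w ⊗ u ⊗ v` is the Kronecker product of its three
factor matrices (up to transposes), so `|⟨S,T⟩| ≤ ‖X_S‖_{S₁} ≤ √(rank X_S)·‖S‖_F` with
`rank X_S ≤ ∑_l rk w_l · rk u_l · rk v_l ≤ r ρ³`: schemes whose factor matrices have rank `≤ ρ`
capture at most `r ρ³` units, WHATEVER their cancellations. -/
def LowFactorRankBound : Prop :=
  ∀ (n r ρ : ℕ) (w u v : Fin r → Leg n → ℂ),
    (∀ l, (legMatrix (w l)).rank ≤ ρ) → (∀ l, (legMatrix (u l)).rank ≤ ρ) →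
    (∀ l, (legMatrix (v l)).rank ≤ ρ) →
      ‖pairT (∑ l, triad (w l) (u l) (v l))‖ ^ 2
        ≤ (r : ℝ) * (ρ : ℝ) ^ 3 * sqn (∑ l, triad (w l) (u l) (v l))

/-- Sharper summed form of the cut bound: `|⟨S,T⟩|² ≤ (∑_l rk w_l · rk u_l · rk v_l) · ‖S‖²`. -/
def CutRankBound : Prop :=
  ∀ (n r : ℕ) (w u v : Fin r → Leg n → ℂ),
    ‖pairT (∑ l, triad (w l) (u l) (v l))‖ ^ 2
      ≤ (∑ l, ((legMatrix (w l)).rank * (legMatrix (u l)).rank * (legMatrix (v l)).rank : ℕ) : ℝ)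
        * sqn (∑ l, triad (w l) (u l) (v l))

/-- **One-leg orthogonality kills all coherent gain** (Schur product: `G = G_w ∘ G_u ∘ G_v ≥ λ_min(Ĝ_w)·I`;
here the extreme case `Ĝ_w = I`): if the factors on one leg are pairwise orthogonal, the scheme
captures at most `r` units — no super-additivity, for every `n` and `r`. -/
def OneLegOrthogonalBound : Prop :=
  ∀ (n r : ℕ) (w u v : Fin r → Leg n → ℂ),
    (∀ l l' : Fin r, l ≠ l' → ∑ a, conj (w l a) * w l' a = 0) →
      ‖pairT (∑ l, triad (w l) (u l) (v l))‖ ^ 2 ≤ (r : ℝ) * sqn (∑ l, triad (w l) (u l) (v l))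

end Summit.MatrixMultiplication.MatrixMultiplication.Cruxes.DiagonalPowerDecay.Ideator3
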